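import Literature.AlgebraicGeometry.HodgeTheory.HeckePrymF21WeilTwelvefoldProofs
import Literature.AlgebraicGeometry.HodgeTheory.WeilClassesRationalPlane
import HarnessLib

/-!
# `exists_heckePrymDatum_F21`: the Weil-class conjunct from Weil TYPE `(6,6)` (van Geemen 4.10)

Second proof file of the named fact
`Literature.AlgebraicGeometry.HodgeTheory.exists_heckePrymDatum_F21` (`HeckePrymF21WeilTwelvefold`).
The first (`HeckePrymF21WeilTwelvefoldProofs`) proved the Hecke-algebra half (the restriction data
`s, t, e_N, s_B, t_B, φ'` and `φ' ≫ φ' = -7`) and reduced the fact to its geometric conjuncts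
verbatim (`exists_heckePrymDatum_F21_of_geometry`), the last of which — "a NON-ZERO RATIONAL
`(6,6)`-class in the single-operator Weil plane
`Eig((𝟙 + φ')^*, (1 + i√7)¹²) ⊔ Eig((𝟙 + φ')^*, (1 - i√7)¹²)` of `P'`" — is there a HYPOTHESIS.
This file DISCHARGES that conjunct from its printed source, the Weil TYPE of `(P', φ')`:

> `(P', ℚ(φ'))` is of Weil type `(6, 6)` and `⋀¹²_K H¹(P', ℚ)` is a rational plane of
> `(6,6)`-classes, which is the single-operator Weil plane ([vanGeemen1994HodgeAV, 4.9, Lemma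
> 5.2 and proof of Thm. 6.12]; [Deligne1982HodgeCycles, Prop. 4.4])

(docstring of the fact), using the tree theorems `isOfHodgeType_of_mem_weilClassesOf` (Deligne–Milne
Prop. 4.4 ⇐, `WeilClassesHodgeType`) and `exists_isRationalClass_hodgeType_of_weilType'`
(`WeilClassesRationalPlane`: the Weil plane is a RATIONAL plane, van Geemen 4.9, inside the
single-operator plane):

* `exists_weilClass_of_weilType_twelvefold` — for ANY complex abelian twelvefold `X` with
  `Φ ≫ Φ = -7` of Weil type `(6, 6)` (`dim (ker(Φ^* - i√7) ∩ H^{1,0}(X)) = 6`), the Weil-class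
  conjunct of the fact holds for `(X, Φ)`;
* `exists_heckePrymDatum_F21_of_weilType` — hence **the named fact follows from: an étale
  `F₂₁`-curve with a Jacobian of dimension `43`, `dim P' = 12`, and Weil type `(6, 6)` of
  `(P', φ')`** — the residue being exactly Riemann's existence theorem for the generating vector
  `(σ, τ, 1; 1, 1, 1)` of `F₂₁` ([LangeRodriguez2022, Thm. 3.1.1]), the Jacobian
  (`Motives.nonempty_jacobian_of_isSmoothProjective`), and the two Chevalley–Weil dimension counts
  `dim P' = 12` (topological) and `dim H^{1,0}(P')_{i√7} = 6` (holomorphic,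
  [ChevalleyWeil1934Integrale]).

Everything is proved; no definition, no named fact (D-0026).

## References

* [LangeRodriguez2022] H. Lange, R. E. Rodríguez, *Decomposition of Jacobians by Prym Varieties*,
  LNM 2310 (2022): Thm. 3.1.1 (PDF p. 52), §3.2 (3.5)–(3.6) (PDF p. 56), §3.5 Cor. 3.5.9–3.5.10
  (PDF pp. 70–71).
* [vanGeemen1994HodgeAV] B. van Geemen, LNM 1594 (1994), 4.9–4.10 (PDF p. 218), Lemma 5.2 (6)
  (PDF p. 220), proof of Thm. 6.12.
* [Deligne1982HodgeCycles] P. Deligne (notes by J. S. Milne), LNM 900 (1982), Prop. 4.4.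
* [ChevalleyWeil1934Integrale] C. Chevalley, A. Weil, Abh. Math. Sem. Hamburg 10 (1934) 358–361.
-/

noncomputable section

namespace Literature.AlgebraicGeometry.HodgeTheory

open CategoryTheory
open Literature.AlgebraicGeometry Literature.AlgebraicGeometry.Motives
open Literature.AlgebraicTopology.SingularHomology

/-! ### A Weil twelvefold of type `(6,6)` for `ℚ(√-7)` carries the Weil class of the fact -/

/-- **The Weil-class conjunct of `exists_heckePrymDatum_F21` holds for every complex abelian
twelvefold of Weil type `(6, 6)` for `ℚ(√-7)`.** For `X` with `dim X = 12`, `Φ ≫ Φ = -7` and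
`dim (ker(Φ^* - i√7) ∩ H^{1,0}(X)) = 6`, there is a non-zero rational class of Hodge type `(6, 6)`
in `Eig((𝟙 + Φ)^*, (1 + i√7)¹²) ⊔ Eig((𝟙 + Φ)^*, (1 - i√7)¹²) ⊆ H¹²(X(ℂ); ℂ)`: the Weil plane
`⋀¹²_K H¹(X, ℚ) ⊗ ℂ = E₊ ⊕ E₋` is a rational plane (van Geemen 4.9;
`exists_isRationalClass_ne_zero_mem_weilClassesOf`) of `(6,6)`-classes (4.10 / Lemma 5.2 (6),
Deligne–Milne Prop. 4.4; `isOfHodgeType_of_mem_weilClassesOf`) inside the single-operator plane.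
[cite: vanGeemen1994HodgeAV, 4.9–4.10 (PDF p. 218) and Lemma 5.2 (6) (PDF p. 220)]
[cite: Deligne1982HodgeCycles, Prop. 4.4] -/
theorem exists_weilClass_of_weilType_twelvefold {X : AbelianVariety ℂ} (hX : X.dim = 12)
    {Φ : X ⟶ X} (hΦ : Φ ≫ Φ = -((7 : ℤ) • 𝟙 X))
    (hbal : Module.finrank ℂ ↥(Module.End.eigenspace (complexBetti.map Φ.hom.hom.hom 1).hom
          (Complex.I * (Real.sqrt (7 : ℝ) : ℂ)) ⊓
        hodgeOneZero (Motives.isSmoothProjective_of_dim_eq' hX)) = 6) :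
    ∃ c : complexBetti X.X 12, c ≠ 0 ∧ IsRationalClass c ∧ IsOfHodgeType 12 X.X 12 6 6 c ∧
      c ∈ Module.End.eigenspace (complexBetti.map (𝟙 X + Φ).hom.hom.hom 12).hom
            ((1 + Complex.I * (Real.sqrt (7 : ℝ) : ℂ)) ^ 12) ⊔
          Module.End.eigenspace (complexBetti.map (𝟙 X + Φ).hom.hom.hom 12).hom
            ((1 - Complex.I * (Real.sqrt (7 : ℝ) : ℂ)) ^ 12) := by
  have hX' : X.dim = 2 * 6 := hX
  have hΦ' : Φ ≫ Φ = -(((7 : ℕ) : ℤ) • 𝟙 X) := by rw [hΦ]; rfl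
  have hbal' : Module.finrank ℂ ↥(Module.End.eigenspace (complexBetti.map Φ.hom.hom.hom 1).hom
          (Complex.I * (Real.sqrt ((7 : ℕ) : ℝ) : ℂ)) ⊓
        hodgeOneZero (Motives.isSmoothProjective_of_dim_eq' hX')) = 6 := by
    simpa only [Nat.cast_ofNat] using hbal
  obtain ⟨c, hc0, hcr, hct, hcm⟩ :=
    exists_isRationalClass_hodgeType_of_weilType' (n := 6) (d := 7) (by norm_num) hX' (by norm_num)
      hΦ' hbal'
  refine ⟨c, hc0, hcr, hct, ?_⟩
  simpa only [Nat.cast_ofNat] using hcm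

/-! ### The named fact from the curve, `dim P' = 12` and Weil type `(6,6)` -/

/-- **`exists_heckePrymDatum_F21` from an étale `F₂₁`-curve with a Jacobian, `dim P' = 12` and Weil
type `(6, 6)` of `(P', φ')`.** If there is a smooth projective complex curve `C` with a Jacobian
`𝒥` of dimension `43` and fixed-point-free automorphisms `σ`, `τ` with `σ⁷ = 𝟙`, `τ³ = 𝟙`,
`σ ≫ τ = τ ≫ σ ≫ σ` (Riemann's existence theorem, [LangeRodriguez2022, Thm. 3.1.1], for the
generating vector `(σ, τ, 1; 1, 1, 1)` of `F₂₁` of type `(3; —)`; Jacobians exist) such that, for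
`s = σ_*`, `t = τ_*`, `e_N = Σ_{i<7} sⁱ` and any restrictions `s_B`, `t_B` to `B = (ker e_N)⁰`,
the fixed component `P' = (ker(𝟙_B - t_B))⁰` has dimension `12` (Chevalley–Weil:
`H¹(P') = H¹(B)^τ` is `24`-dimensional, [LangeRodriguez2022, §3.2 (3.6), §3.5 Cor. 3.5.9–3.5.10])
and, for any `φ'` over the Hecke element `η_B`, `(P', φ')` is of Weil TYPE `(6, 6)` —
`dim (ker(φ'^* - i√7) ∩ H^{1,0}(P')) = 6` (holomorphic Chevalley–Weil: `H^{1,0}(C) = 1 ⊕ 2·Reg`,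
[ChevalleyWeil1934Integrale]) — THEN the named fact holds: the restriction data and
`φ' ≫ φ' = -7` come from `exists_heckePrym_restrictionData`, and the non-zero rational
`(6,6)`-class in the single-operator Weil plane from `exists_weilClass_of_weilType_twelvefold`
(van Geemen 4.9–4.10). Compared with `exists_heckePrymDatum_F21_of_geometry`, the Weil CLASS is
no longer assumed but derived from the Weil TYPE.
[cite: LangeRodriguez2022, Thm. 3.1.1 (PDF p. 52), §3.2 (3.5)–(3.6) (PDF p. 56) and §3.5 Cor. 3.5.9–3.5.10 (PDF pp. 70–71)]
[cite: vanGeemen1994HodgeAV, 4.9–4.10 (PDF p. 218) and Lemma 5.2 (6) (PDF p. 220)] -/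
theorem exists_heckePrymDatum_F21_of_weilType
    (h : ∃ (C : SchemeOver ℂ) (𝒥 : Jacobian C) (σ τ : C ⟶ C),
      IsSmoothProjective 1 C ∧ 𝒥.J.dim = 43 ∧
      σ ≫ σ ≫ σ ≫ σ ≫ σ ≫ σ ≫ σ = 𝟙 C ∧ τ ≫ τ ≫ τ = 𝟙 C ∧ σ ≫ τ = τ ≫ σ ≫ σ ∧
      (∀ P : ComplexPoints C, P ≫ σ ≠ P ∧ P ≫ τ ≠ P) ∧
      ∀ (s t eN : 𝒥.J ⟶ 𝒥.J), s = 𝒥.pushforward 𝒥 σ → t = 𝒥.pushforward 𝒥 τ →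
        eN = 𝟙 𝒥.J + s + s ≫ s + s ≫ s ≫ s + s ≫ s ≫ s ≫ s + s ≫ s ≫ s ≫ s ≫ s +
          s ≫ s ≫ s ≫ s ≫ s ≫ s →
      ∀ (sB tB : AbelianVariety.kerComponent eN ⟶ AbelianVariety.kerComponent eN),
        sB ≫ AbelianVariety.kerComponentι eN = AbelianVariety.kerComponentι eN ≫ s →
        tB ≫ AbelianVariety.kerComponentι eN = AbelianVariety.kerComponentι eN ≫ t →
      ∃ hdim : (AbelianVariety.kerComponent (𝟙 (AbelianVariety.kerComponent eN) - tB)).dim = 12,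
      ∀ φ' : AbelianVariety.kerComponent (𝟙 (AbelianVariety.kerComponent eN) - tB) ⟶
          AbelianVariety.kerComponent (𝟙 (AbelianVariety.kerComponent eN) - tB),
        φ' ≫ AbelianVariety.kerComponentι (𝟙 (AbelianVariety.kerComponent eN) - tB) =
          AbelianVariety.kerComponentι (𝟙 (AbelianVariety.kerComponent eN) - tB) ≫
            (sB + sB ≫ sB + sB ≫ sB ≫ sB ≫ sB - sB ≫ sB ≫ sB - sB ≫ sB ≫ sB ≫ sB ≫ sB -
              sB ≫ sB ≫ sB ≫ sB ≫ sB ≫ sB) →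
        Module.finrank ℂ ↥(Module.End.eigenspace (complexBetti.map φ'.hom.hom.hom 1).hom
              (Complex.I * (Real.sqrt (7 : ℝ) : ℂ)) ⊓
            hodgeOneZero (Motives.isSmoothProjective_of_dim_eq' hdim)) = 6) :
    exists_heckePrymDatum_F21 := by
  obtain ⟨C, 𝒥, σ, τ, hC, hdim, hσ, hτ, hστ, hfree, hgeo⟩ := h
  obtain ⟨s, t, eN, sB, tB, φ', hs, ht, heN, hsB, htB, hφ', hsq⟩ :=
    exists_heckePrym_restrictionData 𝒥 hσ hστ
  obtain ⟨hdimP, hweil⟩ := hgeo s t eN hs ht heN sB tB hsB htB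
  obtain ⟨c, hc0, hcrat, hctype, hcmem⟩ :=
    exists_weilClass_of_weilType_twelvefold hdimP hsq (hweil φ' hφ')
  exact ⟨C, 𝒥, σ, τ, s, t, eN, sB, tB, φ', hC, hdim, hσ, hτ, hστ, hfree, hs, ht, heN, hsB, htB, hφ',
    hdimP, hsq, c, hc0, hcrat, hctype, hcmem⟩

end Literature.AlgebraicGeometry.HodgeTheory

end
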